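import Mathlib
import HarnessLib
import Literature.Computability.QuantumComplexity.StabilizerRank

/-!
# Few cheap symmetric powers span all symmetric powers (Lovitz–Steffan 2022, Prop. 5.5)

Topic `Literature/Computability/QuantumComplexity`; ONE named fact (result in print, `def … : Prop`,
D-0014), vendored while grounding route `QuantumAdvantage/GenericAngle`, support
`Summit.QuantumAdvantage.QuantumAdvantage.Theses.GenericAngle.GenericLeMagic` (item
stmt-QuantumAdvantage-8338: "for every `m` there is a family of at most `(m+1)·χ(T^{⊗2m²})`
stabilizer states on `m` qubits whose span contains every `ψ^{⊗m}`"), whose printed half it is;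
the other half of that item (the angle supply `ψ_j = |0⟩ + √2^j|1⟩` from `2j` copies of `|T⟩` per
qubit by Clifford gates and Pauli/`⟨0|` postselections) is the planner's construction over the
tree's gadget lemmas (`StabilizerSimulationGadgetProofs`: `exists_smul_stabilizer_of_pauliProj`,
`exists_smul_stabilizer_projZ`, `gadgetize`) and is not in print as such.

B. Lovitz, V. Steffan, *New techniques for bounding stabilizer rank*, Quantum **6** (2022) 692 =
arXiv:2110.07781 (held text read, §5 pp. 13–14). With `χ_n := max_{[ψ] ∈ ℙ¹} χ([ψ^{⊗n}])` the
`n`-th GENERIC stabilizer rank (§5, after Fact 5.1: all but finitely many `[ψ]` attain the max):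

> **Proposition 5.5.** Let `r` be a positive integer. If there exists a set of `n+1` distinct
> qubit states `{[ψ₁],…,[ψ_{n+1}]} ⊆ ℙ¹` with `χ([ψᵢ^{⊗n}]) ≤ r` for all `i ∈ [n+1]`, then
> `χ_n ≤ r(n+1)`.
> *Proof.* … by taking the span of the union of all stabilizer states appearing in the
> decompositions of each `[ψᵢ^{⊗n}]`, we have `{[ψ₁^{⊗n}],…,[ψ_{n+1}^{⊗n}]} ⊆ Σ_{r(n+1)}(Stab_n)`.
> The proposition follows from the fact that the affine cone over any set of `n+1` distinct states
> of this form spans `Sⁿ(ℂ²)` …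

and the companion reformulation of `χ_n` used by the route (p. 13):

> **Proposition 5.3.** For any positive integer `n`, there exists a single set of stabilizer
> states `{[σ₁],…,[σ_{χ_n}]} ⊆ Stab_n` for which `Sⁿ(ℂ²) ⊆ span{σ₁,…,σ_{χ_n}}`.

(so `χ_n` = the least size of a stabilizer family whose span contains every `ψ^{⊗n}`; "it follows
… that `χ_n ≥ n+1`", p. 13; `χ_n` "upper bounds `χ([T^{⊗n}])`", p. 13).

## Rendering (the fact is what the printed proof of Prop. 5.5 establishes)

The tree has no `χ_n` and no symmetric subspace `Sⁿ(ℂ²)`; the route `GenericAngle` speaks of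
stabilizer COVERS: families `σ : Fin s → (QReg n → ℂ)` of stabilizer states with
`ψ^{⊗n} ∈ span (range σ)` for every single-qubit `ψ` (`tensorPow`, `stabilizerStates`,
`stabilizerRank` of `StabilizerRank.lean`). In that language Prop. 5.5 (through its proof = the
Prop. 5.3 form of `χ_n`) reads: given `n+1` nonzero, pairwise non-proportional single-qubit
vectors `ψ₀,…,ψ_n` ("distinct qubit states `[ψᵢ] ∈ ℙ¹`") with `χ(ψᵢ^{⊗n}) ≤ r`, there is a
stabilizer family of size `≤ r(n+1)` whose span contains `ψ^{⊗n}` for EVERY `ψ : QReg 1 → ℂ`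
(the union of the `n+1` decompositions; `n+1` distinct `n`-th powers span `Sⁿ(ℂ²) ∋ ψ^{⊗n}` —
Vandermonde on binary forms). This implies the printed conclusion `χ(ψ^{⊗n}) ≤ r(n+1)` for all
`ψ` (`stabilizerRank_le_card`, `Submodule.mem_span_range_iff_exists_fun`). Corner `n = 0`:
`ψ^{⊗0}` is the scalar `1 = |0⁰⟩`, a stabilizer state, and `r ≥ χ(ψ₀^{⊗0}) = 1`, so the
statement holds with the one-element family. `r = 0` makes the hypotheses contradictory
(`χ(ψᵢ^{⊗n}) = 0` forces `ψᵢ^{⊗n} = 0`), as in print ("let `r` be a positive integer").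
Provable now (linear algebra); vendored as a fact so that the route item splits cleanly into
"printed transfer" + "angle supply".

## Tree / Mathlib search

`lean search 'Vandermonde.*(tensorPow|span)|symmetricSubspace|Dicke'` — nothing for qubit
registers (Mathlib has `Matrix.vandermonde` and `TensorPower`/`SymmetricPower` abstractly, not
tied to `QReg n → ℂ`); stabilizer-rank API: `stabilizerRank_le_card`, `exists_stabilizerDecomposition`,
`stabilizerRank_le_two_pow` (`StabilizerSimulationProofs.lean`), `tensorPow_add`
(`MagicStatePairs.lean`). No `LovitzSteffan2022_*` declaration existed.

## References

* [LovitzSteffan2022] B. Lovitz, V. Steffan, Quantum 6 (2022) 692, arXiv:2110.07781: §5, Fact 5.1,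
  Prop. 5.3 (p. 13), Prop. 5.5 (p. 14).
* S. Bravyi, G. Smith, J. A. Smolin, *Trading classical and quantum computational resources*,
  PRX 6 (2016) 021043 (stabilizer rank of `|H⟩^{⊗n}`). [BravyiSmithSmolin2016]
-/

noncomputable section

namespace Literature.Computability.QuantumComplexity

/-- **Lovitz–Steffan 2022, Proposition 5.5** (cheap distinct angles bound the generic stabilizer
rank), in the stabilizer-cover form its proof establishes (= the Prop. 5.3 description of `χ_n`):
*if `n+1` distinct qubit states `[ψ₀],…,[ψ_n] ∈ ℙ¹` satisfy `χ([ψᵢ^{⊗n}]) ≤ r`, then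
`χ_n ≤ r(n+1)`* — i.e. there is ONE family of at most `r(n+1)` `n`-qubit stabilizer states (the
union of the `n+1` decompositions) whose linear span contains `ψ^{⊗n}` for every single-qubit
vector `ψ` (because `n+1` pairwise non-proportional `n`-th tensor powers span the symmetric
subspace `Sⁿ(ℂ²)`). "Distinct states of `ℙ¹`" is rendered as nonzero and pairwise
non-proportional vectors `QReg 1 → ℂ`. [cite: LovitzSteffan2022, Prop. 5.5 (p. 14, with its proof) and Prop. 5.3 (p. 13)] -/
def LovitzSteffan2022_stabilizerCover_of_distinctPowers : Prop :=
  ∀ (n r : ℕ) (ψs : Fin (n + 1) → Cryptography.QReg 1 → ℂ),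
    (∀ i, ψs i ≠ 0) →
    (∀ i j, i ≠ j → ∀ c : ℂ, ψs i ≠ c • ψs j) →
    (∀ i, stabilizerRank (tensorPow (ψs i) n) ≤ r) →
    ∃ (s : ℕ) (σ : Fin s → Cryptography.QReg n → ℂ),
      s ≤ r * (n + 1) ∧ (∀ k, σ k ∈ stabilizerStates n) ∧
      ∀ ψ : Cryptography.QReg 1 → ℂ, tensorPow ψ n ∈ Submodule.span ℂ (Set.range σ)

/-- Unfolding lemma. [folklore] -/
theorem LovitzSteffan2022_stabilizerCover_of_distinctPowers_iff :
    LovitzSteffan2022_stabilizerCover_of_distinctPowers ↔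
      ∀ (n r : ℕ) (ψs : Fin (n + 1) → Cryptography.QReg 1 → ℂ),
        (∀ i, ψs i ≠ 0) →
        (∀ i j, i ≠ j → ∀ c : ℂ, ψs i ≠ c • ψs j) →
        (∀ i, stabilizerRank (tensorPow (ψs i) n) ≤ r) →
        ∃ (s : ℕ) (σ : Fin s → Cryptography.QReg n → ℂ),
          s ≤ r * (n + 1) ∧ (∀ k, σ k ∈ stabilizerStates n) ∧
          ∀ ψ : Cryptography.QReg 1 → ℂ, tensorPow ψ n ∈ Submodule.span ℂ (Set.range σ) :=
  Iff.rfl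

/-- **The printed conclusion follows from the cover form**: under
`LovitzSteffan2022_stabilizerCover_of_distinctPowers`, `n+1` distinct cheap angles give
`χ(ψ^{⊗n}) ≤ r(n+1)` for EVERY single-qubit `ψ` (i.e. `χ_n ≤ r(n+1)`): `ψ^{⊗n}` lies in the span
of the cover, so it is a combination of its `s ≤ r(n+1)` stabilizer states. [cite: LovitzSteffan2022, Prop. 5.5] -/
theorem LovitzSteffan2022_stabilizerCover_of_distinctPowers.stabilizerRank_le
    (h : LovitzSteffan2022_stabilizerCover_of_distinctPowers)
    (n r : ℕ) (ψs : Fin (n + 1) → Cryptography.QReg 1 → ℂ)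
    (h0 : ∀ i, ψs i ≠ 0) (hd : ∀ i j, i ≠ j → ∀ c : ℂ, ψs i ≠ c • ψs j)
    (hr : ∀ i, stabilizerRank (tensorPow (ψs i) n) ≤ r) (ψ : Cryptography.QReg 1 → ℂ) :
    stabilizerRank (tensorPow ψ n) ≤ r * (n + 1) := by
  obtain ⟨s, σ, hs, hσ, hspan⟩ := h n r ψs h0 hd hr
  obtain ⟨c, hc⟩ := (Submodule.mem_span_range_iff_exists_fun ℂ).1 (hspan ψ)
  refine le_trans (Nat.sInf_le ⟨c, σ, hσ, hc.symm⟩) hs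

end Literature.Computability.QuantumComplexity

end
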